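import Summits.HodgeConjecture.HodgeConjecture.Theorems.F0P2eStubLRLocalReindex        -- ★ p808692: carrier on `U(diag dV)` itself (`ι = id`): irreducible, local isotypy; LR
import Summits.HodgeConjecture.HodgeConjecture.Theorems.F0P2eStubLTLocalTypeTransport  -- ★ p808809: LT `stubLT_of_LR`
import Summits.HodgeConjecture.HodgeConjecture.Theorems.F0P2eStubLWLocalWitness         -- ★ p808696: LW `stubLW_holds`
import Summits.HodgeConjecture.HodgeConjecture.Theorems.F0P2gStubNSINontrivialClassNotSpherical  -- ★ p813978: NSI closer (ROAD δ)
import Literature.NumberTheory.Automorphic.UnitaryGroupLocalTypeSpherical               -- ★ Flath: `isSpherical_localType_cofinite'`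
import Literature.NumberTheory.Automorphic.ParabolicInductionAdmissibleProofs          -- ★ `Representation.Equiv.fixedPoints_eq_map`
import HarnessLib

/-!
# FLOOR-0 P2 — ROAD δ COROLLARY: THE TRIVIAL CLASS IS SPHERICAL ALMOST EVERYWHERE (the converse of NSI), hence the EXACT good-place
# dictionary «Liu's local theta type `X_v(μ, ε, χ)` has a `U(diag dV)(𝒪_v)`-spherical line ⟺ `[ε]_v = 1`», uniformly in the line `ε`

Cell hodgecm-mathlib (D-0151), FLOOR 0, programme P2 (theta ∕ `hdictE`); crux item H413 = stmt-HodgeConjecture-24833 (`HCCMUnconditional.H413`),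
rung-3 sub-line `Cruxes/H413/Lines/F0_P2PKRung3.lean` (v1.2: open set {PKΠ = ENGINE}; NSI ★ by ROAD δ).  Seat F0P2-p01 (g5) — self-placed small row
announced on the P2 bus 2026-08-31T07:3xZ (ROAD-δ corollary booking, as ★ p814232 `F0P2gNSIAnySplitting`).  THEOREMS ONLY (no `def`, no instance,
no notation, no named fact, no `sorry`); never imports a `Cruxes/…/Lines` module (s347 ∕ s380b); `--supports stmt-HodgeConjecture-24833 --as helper`.
HC_CM is proved only modulo the printed citations until rung 0 closes; this file discharges none of them and uses none: it is assembled from ★ kernel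
facts only.

WHAT IT SAYS.  `L` CM, `L⁺ = maximalRealSubfield L`, `δ = imagUnit L`, `e₁` a frame enumeration, `dV` a real non-degenerate diagonal, `μ`
conjugate-symplectic, `χ` a character datum; `X_v(μ, ε, χ)[e₁]` = Liu's local theta type at the finite place `v` of `L⁺` and the line `ε ∈ (L⁺)ˣ`
(the `χ_W`-twisted coinvariants of the local Weil representation `ω_{𝓢,v}` of the `μ`-splitting family ★ `OmegaChiSplitting.chiLocalSplittingsD`,
restricted to `U(diag dV)(L⁺_v)` along `k ↦ k ⊗ 1`, ★ `UnitaryGroup.localLineInl`) — the representation of the registered letters PK ∕ PKΠ ∕ NSI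
verbatim.
* §0 `isSpherical_of_equiv` — sphericity (`dim V^K = 1`, ★ `Representation.IsSpherical`) passes along a Mathlib `Representation.Equiv`
  (★ `Representation.Equiv.fixedPoints_eq_map` + `LinearEquiv.finrank_map_eq`); `eventually_isSpherical_of_irreducible_admissible` — ★ Flath
  `isSpherical_localType_cofinite'` with the `Nontrivial` instance supplied from irreducibility.
* §1 `conj_one_frame`, `frameTransport_id` — the trivial frame `g := 1`, `ιV := id` of `H := diag dV` satisfies the (C)-desk's frame hypotheses.
* §2 **`eventually_isSpherical_localType_chi`** — for every line `a ∈ (L⁺)ˣ`: `X_v(μ, a, χ)[e₁]` IS `U(diag dV)(𝒪_v)`-spherical for all but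
  finitely many `v`.  Proof: the carrier `ω(μ, a, χ)[e₁]` on `U(diag dV)(𝔸_{L⁺,f})` itself (`ι = id`) is irreducible (★ `rhoAtLine_chi_id_isIrreducible`)
  and admissible (★ `F0P2cStubCI.rhoAtLine_chi_isAdmissible` at the trivial frame), and `X_v(μ, a, χ)[e₁]` is its irreducible local type at every `v`
  (★ `isIrreducible_localType_chi`, ★ `isotypicComponent_rhoAtLine_chi_id_comp_inclPlace`); Flath's theorem ★ gives sphericity at almost every `v`.
* §3 **`eventually_forall_isSpherical_of_locF_eq_one`** — THE CONVERSE OF NSI, UNIFORMLY IN THE LINE: for all but finitely many `v`, EVERY `ε` with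
  `[ε]_v = 1` has `X_v(μ, ε, χ)[e₁]` spherical.  Proof: §2 at `a := 1`; at such a `v`, `[1]_v = [ε]_v` gives a local norm witness (★ LW `stubLW_holds`),
  hence `X_v(μ, 1, χ) ≃ X_v(μ, ε, χ)` (★ LT `stubLT_of_LR` ∘ ★ LR `stubLR_holds`), and §0 transports sphericity.
* §4 **`eventually_forall_isSpherical_iff_locF_eq_one`** — THE EXACT GOOD-PLACE DICTIONARY: for all but finitely many `v` and every `ε ∈ (L⁺)ˣ`,
  `X_v(μ, ε, χ)[e₁]` is `U(diag dV)(𝒪_v)`-spherical **iff** `[ε]_v = 1` (NSI ★ `stubNSI_holds` is «⇒», §3 is «⇐»).  In print: at an unramified place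
  the two members of Liu's local pair `{X_v(μ, e, χ)}_e = Π(ξ_v) = {πⁿ(ξ_v), πˢ(ξ_v)}` are told apart by the hyperspecial line — `πⁿ(ξ_v)` (the trivial
  class) is the unramified constituent of `i_G(χ_ξ)`, `πˢ(ξ_v)` (the non-trivial class) is supercuspidal [GelbartRogawski1991 Lem 5.1.2 p. 466, p. 467;
  Rogawski1990 §12.2 p. 174, Prop 13.1.3 (d); HarrisKudlaSweet1996 Thm 6.1].  This is the theta-side, label-free shadow of the dictionary rows DICT_v ∕
  DICTn of PLAN-P2 v5 (§4 of the PK rung-3 sub-line; §E3♭) at the good places, kernel-checked with NO printed citation: which member of Liu's pair is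
  the unramified one, almost everywhere.  (The labelled identification `X_v(μ,1,χ) ≅ πⁿ(ξ_v)` — Satake parameters — is NOT claimed here.)

## References
* [GelbartRogawski1991] S. Gelbart, J. Rogawski, Invent. Math. 105 (1991): Lem 5.1.2 p. 466, §1.4 p. 451, p. 467.
* [Rogawski1990] J. Rogawski, Ann. of Math. Stud. 123 (1990): §12.2 p. 174, Prop 13.1.3 (d) p. 192.
* [HarrisKudlaSweet1996] M. Harris, S. Kudla, W. J. Sweet, J. AMS 9 (1996): Thm 6.1, Cor 8.3.
* [FlathCorvallis1979] D. Flath, PSPM 33.1 (1979): §2 Example 2, Thm 2.  [Bump1997] D. Bump, CUP 1997: Prop 3.4.2.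
* [Liu2021] Y. Liu, Camb. J. Math. 9 (2021) = arXiv:2102.11518: Def 4.11, App. D Lem D.1 (1), (3).
* [MoeglinVignerasWaldspurger1987] LNM 1291: Chap. 2 II.1 (A)–(B), Chap. 3 I.1–I.3 (line transport).
-/

set_option autoImplicit false
-- the mandated namespace has the single-problem summit's repeated segment (`HodgeConjecture.HodgeConjecture`)
set_option linter.dupNamespace false

noncomputable section

namespace Summit.HodgeConjecture.HodgeConjecture.Cruxes.H413.F0P2gTrivialClassSpherical

open NumberField IsDedekindDomain Filter
open scoped Matrix ComplexOrder
open Literature.NumberTheory Literature.NumberTheory.Automorphic Literature.NumberTheory.Automorphic.UnitaryGroup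
open Literature.NumberTheory.Automorphic.IdeleClassGroup
open Literature.NumberTheory.Automorphic.Liu2021 Literature.NumberTheory.Automorphic.Liu2021.Def411WeilCarriers
open Literature.NumberTheory.Automorphic.Liu2021.Def411WeilCarriersDoubling
open Literature.NumberTheory.GelbartRogawski1991 Literature.NumberTheory.GelbartRogawski1991.UnitaryDualPair
open Literature.NumberTheory.GelbartRogawski1991.UnitaryDualPair.WeilCoinv
open Literature.RepresentationTheory Literature.RepresentationTheory.Liu2021
open Summit.HodgeConjecture.CorCM.Transposition
open Summit.HodgeConjecture.HodgeConjecture.Cruxes.H413.F0P2cOmegaLocalType (isIrreducible_localType_chi)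

/-! ## §0 Two generic transports -/

/-- **Sphericity passes along an equivalence of representations**: if `e : ρ ≃ σ` (Mathlib `Representation.Equiv`) and `dim_k ρ^K = 1` then
`dim_k σ^K = 1` — `σ^K = e(ρ^K)` (★ `Representation.Equiv.fixedPoints_eq_map`) and a linear equivalence preserves `finrank`
(`LinearEquiv.finrank_map_eq`). [cite: Bump1997, Prop 3.4.2] -/
theorem isSpherical_of_equiv {k G V W : Type*} [Field k] [Group G] [AddCommGroup V] [Module k V] [AddCommGroup W] [Module k W]
    {ρ : Representation k G V} {σ : Representation k G W} (e : ρ.Equiv σ) (K : Subgroup G) (h : ρ.IsSpherical K) :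
    σ.IsSpherical K := by
  rw [Representation.IsSpherical] at h ⊢
  rw [Representation.Equiv.fixedPoints_eq_map e K, LinearEquiv.finrank_map_eq]
  exact h

/-- **Flath's a.e. sphericity of local types, with the non-triviality of the carrier supplied by irreducibility**: for an irreducible admissible
representation `ω` of `U(J)(𝔸_{F,f})` and irreducible local types `τ_v` (`ω ∘ inclPlace v` `τ_v`-isotypic), `τ_v` is `U(J)(𝒪_v)`-spherical for
all but finitely many `v` (★ `UnitaryGroup.isSpherical_localType_cofinite'`; `Nontrivial W` from ★ `Representation.IsIrreducible.nontrivial`).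
[cite: FlathCorvallis1979, §2 Example 2, Thm 2] [cite: Bump1997, Prop 3.4.2] -/
theorem eventually_isSpherical_of_irreducible_admissible (F E : Type) [Field F] [NumberField F] [Field E] [NumberField E] [Algebra F E]
    (c : E ≃ₐ[F] E) (N : ℕ) (J : Matrix (Fin N) (Fin N) E) {W : Type} [AddCommGroup W] [Module ℂ W]
    (ω : Representation ℂ (finAdelic F E c N J) W) (hirr : ω.IsIrreducible) (hω : ω.IsAdmissible)
    {T : HeightOneSpectrum (𝓞 F) → Type} [∀ v, AddCommGroup (T v)] [∀ v, Module ℂ (T v)]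
    (τ : ∀ v, Representation ℂ (localPi E c N J v) (T v)) (hτirr : ∀ v, (τ v).IsIrreducible)
    (hτ : ∀ v, isotypicComponent (MonoidAlgebra ℂ (localPi E c N J v)) (Representation.asModule (ω.comp (inclPlace F E c N J v)))
      (Representation.asModule (τ v)) = ⊤) :
    ∀ᶠ v in cofinite, (τ v).IsSpherical (localInt E c N J v) := by
  haveI := hirr
  haveI : Nontrivial W := Representation.IsIrreducible.nontrivial ω
  exact isSpherical_localType_cofinite' F E c N J ω hω τ hτirr hτ

/-! ## §1 The trivial frame of `H := diag dV` (`g := 1`, `ιV := id`) satisfies the (C)-desk's frame hypotheses -/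

/-- `ᵗ(c̄ 1) · diag dV · 1 = diag dV`. [folklore] -/
theorem conj_one_frame (L : Type) [Field L] [NumberField L] [IsCMField L] (dV : Fin 3 → L) :
    (((1 : GL (Fin 3) L) : Matrix (Fin 3) (Fin 3) L).map (cmConjRingHom L))ᵀ * Matrix.diagonal dV * ((1 : GL (Fin 3) L) : Matrix (Fin 3) (Fin 3) L) =
      Matrix.diagonal dV := by
  simp [Matrix.map_one]

/-- The identity transport is pinned by the trivial frame: `id k = 1_f⁻¹ · k · 1_f`. [folklore] -/
theorem frameTransport_id (L : Type) [Field L] [NumberField L] [IsCMField L] (dV : Fin 3 → L) :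
    ∀ k : finAdelic (↥(maximalRealSubfield L)) L (IsCMField.complexConj L) 3 (Matrix.diagonal dV),
      ((MonoidHom.id (finAdelic (↥(maximalRealSubfield L)) L (IsCMField.complexConj L) 3 (Matrix.diagonal dV)) k :
          finAdelic (↥(maximalRealSubfield L)) L (IsCMField.complexConj L) 3 (Matrix.diagonal dV)) :
          GL (Fin 3) (FiniteAdeleRing (𝓞 L) L)) =
        (toFinAdeleGL L 3 (1 : GL (Fin 3) L))⁻¹ * (k : GL (Fin 3) (FiniteAdeleRing (𝓞 L) L)) * toFinAdeleGL L 3 (1 : GL (Fin 3) L) := by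
  intro k
  simp [map_one]

/-! ## §2 The local theta type of EVERY line is spherical almost everywhere -/

section Main

variable (L : Type) [Field L] [NumberField L] [IsCMField L] {n' : ℕ} (e₁ : Fin 3 × Fin 1 ≃ Fin n') (dV : Fin 3 → L)
  (hdV : ∀ i, IsCMField.complexConj L (dV i) = dV i) (hdV0 : ∀ i, dV i ≠ 0)
  (μ : Literature.NumberTheory.Automorphic.IdeleClassGroup L →ₜ* Circle) (hμ : IsConjugateSymplectic L μ)

set_option synthInstance.maxHeartbeats 400000 in
set_option maxHeartbeats 8000000 in
/-- **`X_v(μ, a, χ)[e₁]` is `U(diag dV)(𝒪_v)`-SPHERICAL FOR ALL BUT FINITELY MANY `v`**, for every line `a ∈ (L⁺)ˣ`: Flath ★ at the irreducible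
admissible carrier `ω(μ, a, χ)[e₁]` on `U(diag dV)(𝔸_{L⁺,f})` (`ι := id`; ★ `rhoAtLine_chi_id_isIrreducible`, ★ `F0P2cStubCI.rhoAtLine_chi_isAdmissible` at the
trivial frame §1) whose irreducible local type at `v` is `X_v(μ, a, χ)[e₁]` (★ `isIrreducible_localType_chi`, ★ `isotypicComponent_rhoAtLine_chi_id_comp_inclPlace`).
[cite: FlathCorvallis1979, §2 Example 2, Thm 2] [cite: Liu2021, Def 4.11, App. D Lem D.1 (1)] [cite: GelbartRogawski1991, Lem 5.1.2 p. 466] -/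
theorem eventually_isSpherical_localType_chi (a : (↥(maximalRealSubfield L))ˣ)
    (χ : Chi (↥(maximalRealSubfield L)) L (IsCMField.complexConj L)) :
    ∀ᶠ v in cofinite,
      Representation.IsSpherical
        (show Representation ℂ (localPi L (IsCMField.complexConj L) 3 (Matrix.diagonal dV) v) _ from
          (TwistedCoinv.rep (localCharOfCenter (↥(maximalRealSubfield L)) L (IsCMField.complexConj L)
              (JW (↥(maximalRealSubfield L)) L a) (JW_apply_ne_zero (↥(maximalRealSubfield L)) L a) χ.1 v)
            ((OmegaChiSplitting.chiLocalSplittingsD ⟨L⟩ e₁ dV hdV hdV0 (toHeckeCharacter L μ)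
              ((isOscillatorChar_toHeckeCharacter_iff μ).mpr hμ) a).omegaLoc v)
            (commute_omegaLoc_localCenter (↥(maximalRealSubfield L)) L (IsCMField.complexConj L) 3 e₁ (Matrix.diagonal dV)
              (JW (↥(maximalRealSubfield L)) L a) (complexConj_imagUnit L) (imagUnit_ne_zero L) (imagUnit_mul_self L)
              (realDiagonal_isSymm L dV hdV) (isSymm_TW (↥(maximalRealSubfield L)) a) (realDiagonal_map L dV hdV).symm
              (JW_eq (↥(maximalRealSubfield L)) L a) (JW_apply_ne_zero (↥(maximalRealSubfield L)) L a)
              (OmegaChiSplitting.chiLocalSplittingsD ⟨L⟩ e₁ dV hdV hdV0 (toHeckeCharacter L μ)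
                ((isOscillatorChar_toHeckeCharacter_iff μ).mpr hμ) a) v)).comp
            (UnitaryGroup.localLineInl L (IsCMField.complexConj L) 3 e₁ (Matrix.diagonal dV) (JW (↥(maximalRealSubfield L)) L a) v))
        (localInt L (IsCMField.complexConj L) 3 (Matrix.diagonal dV) v) :=
  eventually_isSpherical_of_irreducible_admissible (↥(maximalRealSubfield L)) L (IsCMField.complexConj L) 3 (Matrix.diagonal dV)
    (rhoAtLine (↥(maximalRealSubfield L)) L (IsCMField.complexConj L) 3 e₁ (Matrix.diagonal dV) (complexConj_imagUnit L)
        (imagUnit_ne_zero L) (imagUnit_mul_self L) (realDiagonal_isSymm L dV hdV) (isUnit_det_realDiagonal L dV hdV hdV0)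
        (realDiagonal_map L dV hdV).symm
        (fun a => isCompatible_chiSplittingLine L e₁ dV hdV hdV0 (toHeckeCharacter L μ) (isUnitary_toHeckeCharacter L μ)
          ((isOscillatorChar_toHeckeCharacter_iff μ).mpr hμ) (TW (↥(maximalRealSubfield L)) a)
          (isSymm_TW (↥(maximalRealSubfield L)) a) (isUnit_det_TW (↥(maximalRealSubfield L)) a)
          (JW (↥(maximalRealSubfield L)) L a) (JW_eq (↥(maximalRealSubfield L)) L a))
        (MonoidHom.id (finAdelic (↥(maximalRealSubfield L)) L (IsCMField.complexConj L) 3 (Matrix.diagonal dV))) a χ)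
    (F0P2eStubLRLocalReindex.rhoAtLine_chi_id_isIrreducible L dV hdV hdV0 μ hμ a χ e₁)
    (F0P2cStubCI.rhoAtLine_chi_isAdmissible L (Matrix.diagonal dV) e₁ dV hdV hdV0 1 (conj_one_frame L dV)
      (MonoidHom.id (finAdelic (↥(maximalRealSubfield L)) L (IsCMField.complexConj L) 3 (Matrix.diagonal dV))) (frameTransport_id L dV) μ hμ a χ)
    _ (fun v => isIrreducible_localType_chi L e₁ dV hdV hdV0 μ hμ a χ v)
    (fun v => F0P2eStubLRLocalReindex.isotypicComponent_rhoAtLine_chi_id_comp_inclPlace L dV hdV hdV0 μ hμ a χ e₁ v)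

/-! ## §3 The converse of NSI, uniformly in the line -/

set_option synthInstance.maxHeartbeats 400000 in
set_option maxHeartbeats 8000000 in
/-- **THE TRIVIAL CLASS IS SPHERICAL, ALMOST EVERYWHERE, UNIFORMLY IN THE LINE** (converse of the registered NSI): for all but finitely many finite
places `v` of `L⁺`, every `ε ∈ (L⁺)ˣ` with `[ε]_v = 1` (`locF L⁺ δ² ε v = 1`) has `X_v(μ, ε, χ)[e₁]` `U(diag dV)(𝒪_v)`-spherical.  Proof: §2 at
`a := 1`; at such a `v`, `[1]_v = [ε]_v` yields a local norm witness `x` with `ε⁻¹δ = x x̄ · δ` (★ LW `stubLW_holds`), hence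
`X_v(μ, 1, χ)[e₁] ≃ X_v(μ, ε, χ)[e₁]` (★ LT `stubLT_of_LR` over ★ LR `stubLR_holds`), and sphericity passes along the equivalence (§0).
[cite: Liu2021, App. D Lem D.1 (3)] [cite: MoeglinVignerasWaldspurger1987, Chap. 2 II.1 (A)–(B), Chap. 3 I.1–I.3] [cite: GelbartRogawski1991, Lem 5.1.2 p. 466] -/
theorem eventually_forall_isSpherical_of_locF_eq_one (χ : Chi (↥(maximalRealSubfield L)) L (IsCMField.complexConj L)) :
    ∀ᶠ v in cofinite, ∀ ε : (↥(maximalRealSubfield L))ˣ,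
      locF (↥(maximalRealSubfield L)) (imagUnitSq L) ε v = 1 →
        Representation.IsSpherical
          (show Representation ℂ (localPi L (IsCMField.complexConj L) 3 (Matrix.diagonal dV) v) _ from
            (TwistedCoinv.rep (localCharOfCenter (↥(maximalRealSubfield L)) L (IsCMField.complexConj L)
                (JW (↥(maximalRealSubfield L)) L ε) (JW_apply_ne_zero (↥(maximalRealSubfield L)) L ε) χ.1 v)
              ((OmegaChiSplitting.chiLocalSplittingsD ⟨L⟩ e₁ dV hdV hdV0 (toHeckeCharacter L μ)
                ((isOscillatorChar_toHeckeCharacter_iff μ).mpr hμ) ε).omegaLoc v)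
              (commute_omegaLoc_localCenter (↥(maximalRealSubfield L)) L (IsCMField.complexConj L) 3 e₁ (Matrix.diagonal dV)
                (JW (↥(maximalRealSubfield L)) L ε) (complexConj_imagUnit L) (imagUnit_ne_zero L) (imagUnit_mul_self L)
                (realDiagonal_isSymm L dV hdV) (isSymm_TW (↥(maximalRealSubfield L)) ε) (realDiagonal_map L dV hdV).symm
                (JW_eq (↥(maximalRealSubfield L)) L ε) (JW_apply_ne_zero (↥(maximalRealSubfield L)) L ε)
                (OmegaChiSplitting.chiLocalSplittingsD ⟨L⟩ e₁ dV hdV hdV0 (toHeckeCharacter L μ)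
                  ((isOscillatorChar_toHeckeCharacter_iff μ).mpr hμ) ε) v)).comp
              (UnitaryGroup.localLineInl L (IsCMField.complexConj L) 3 e₁ (Matrix.diagonal dV) (JW (↥(maximalRealSubfield L)) L ε) v))
          (localInt L (IsCMField.complexConj L) 3 (Matrix.diagonal dV) v) := by
  filter_upwards [eventually_isSpherical_localType_chi L e₁ dV hdV hdV0 μ hμ 1 χ] with v hv ε hε
  -- `[1]_v = [ε]_v`
  have hcl : locF (↥(maximalRealSubfield L)) (imagUnitSq L) 1 v = locF (↥(maximalRealSubfield L)) (imagUnitSq L) ε v := by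
    rw [map_one, Pi.one_apply, hε]
  -- LW: the local norm witness; LT: the line transport `X_v(μ,1,χ) ≃ X_v(μ,ε,χ)`
  obtain ⟨x, hx⟩ := F0P2eStubLWLocalWitness.stubLW_holds L 1 ε v hcl
  obtain ⟨E⟩ := F0P2eStubLTLocalTypeTransport.stubLT_of_LR F0P2eStubLRLocalReindex.stubLR_holds L e₁ dV hdV hdV0 μ hμ 1 ε χ v x hx
  exact isSpherical_of_equiv E _ hv

/-! ## §4 The exact good-place dictionary -/

set_option synthInstance.maxHeartbeats 400000 in
set_option maxHeartbeats 8000000 in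
/-- **THE EXACT GOOD-PLACE DICTIONARY — `X_v(μ, ε, χ)[e₁]` is `U(diag dV)(𝒪_v)`-spherical iff `[ε]_v = 1`, for all but finitely many `v` and
every `ε ∈ (L⁺)ˣ`**: «⇒» is the registered NSI (★ `F0P2gStubNSINontrivialClassNotSpherical.stubNSI_holds`, ROAD δ), «⇐» is §3.  In print: at an
unramified place Liu's pair `{X_v(μ, e, χ)}_e` is Rogawski's `Π(ξ_v) = {πⁿ(ξ_v), πˢ(ξ_v)}`, `πⁿ` (trivial class) unramified, `πˢ` (non-trivial class)
supercuspidal — here told apart in the kernel by the hyperspecial line, with no printed citation.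
[cite: GelbartRogawski1991, Lem 5.1.2 p. 466, p. 467] [cite: Rogawski1990, §12.2 p. 174, Prop 13.1.3 (d)] [cite: HarrisKudlaSweet1996, Thm 6.1] -/
theorem eventually_forall_isSpherical_iff_locF_eq_one (χ : Chi (↥(maximalRealSubfield L)) L (IsCMField.complexConj L)) :
    ∀ᶠ v in cofinite, ∀ ε : (↥(maximalRealSubfield L))ˣ,
      Representation.IsSpherical
        (show Representation ℂ (localPi L (IsCMField.complexConj L) 3 (Matrix.diagonal dV) v) _ from
          (TwistedCoinv.rep (localCharOfCenter (↥(maximalRealSubfield L)) L (IsCMField.complexConj L)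
              (JW (↥(maximalRealSubfield L)) L ε) (JW_apply_ne_zero (↥(maximalRealSubfield L)) L ε) χ.1 v)
            ((OmegaChiSplitting.chiLocalSplittingsD ⟨L⟩ e₁ dV hdV hdV0 (toHeckeCharacter L μ)
              ((isOscillatorChar_toHeckeCharacter_iff μ).mpr hμ) ε).omegaLoc v)
            (commute_omegaLoc_localCenter (↥(maximalRealSubfield L)) L (IsCMField.complexConj L) 3 e₁ (Matrix.diagonal dV)
              (JW (↥(maximalRealSubfield L)) L ε) (complexConj_imagUnit L) (imagUnit_ne_zero L) (imagUnit_mul_self L)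
              (realDiagonal_isSymm L dV hdV) (isSymm_TW (↥(maximalRealSubfield L)) ε) (realDiagonal_map L dV hdV).symm
              (JW_eq (↥(maximalRealSubfield L)) L ε) (JW_apply_ne_zero (↥(maximalRealSubfield L)) L ε)
              (OmegaChiSplitting.chiLocalSplittingsD ⟨L⟩ e₁ dV hdV hdV0 (toHeckeCharacter L μ)
                ((isOscillatorChar_toHeckeCharacter_iff μ).mpr hμ) ε) v)).comp
            (UnitaryGroup.localLineInl L (IsCMField.complexConj L) 3 e₁ (Matrix.diagonal dV) (JW (↥(maximalRealSubfield L)) L ε) v))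
        (localInt L (IsCMField.complexConj L) 3 (Matrix.diagonal dV) v) ↔
        locF (↥(maximalRealSubfield L)) (imagUnitSq L) ε v = 1 := by
  filter_upwards [F0P2gStubNSINontrivialClassNotSpherical.stubNSI_holds L e₁ dV hdV hdV0 μ hμ χ,
    eventually_forall_isSpherical_of_locF_eq_one L e₁ dV hdV hdV0 μ hμ χ] with v hN hT ε
  exact ⟨hN ε, hT ε⟩

end Main

end Summit.HodgeConjecture.HodgeConjecture.Cruxes.H413.F0P2gTrivialClassSpherical

end
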